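import Summits.CriticalPhenomena.PercolationContinuityZ3.Theorems.PercNearOneGluingNoHeavyLowerTailCornerEventGluing
import HarnessLib

/-!
# `NoHeavyLowerTail` (stmt-CriticalPhenomena-4575) — corner programme, layer 4:
# WORST-RELAY GLUING (Kozma–Nitzan Question 7 / kcluster's (U1)) AT THE RELIABLE CORNER, every relay set

(U1): `P(o ↔ A, o ↮ b) ≤ P(o ↔ A, a* ↮ b)` for the LEAST reliable relay `a*` (Kozma–Nitzan arXiv:2401.12397
Question 7 in its exit form; `…WorstRelayGluing`: (U1) ⇒ event gluing ⇒ both cruxes, proved for `|A| ≤ 2`).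
Here: its leading-order version at the reliable corner `w = 1 − ε·λ`, for EVERY `|A|`, in the regime of
`…CornerEventGluing.leading_exit_le` (every relay's disconnection event has order `≥ m`, the order of the exit
event): for every relay `s` maximising the order-`m` coefficient of `{s ↮ b}` ("least reliable at leading order"),
`L_m({o ↔ A} ∩ {o ↮ b}) ≤ L_m({o ↔ A} ∩ {s ↮ b})` (`Corner.leading_exit_le_worstRelay`).

New combinatorial input (on top of layers 1–3): the STRANDED-OBSERVER LEMMA `Corner.card_bdry_clus_eq_zero_of_stranded`
— in a minimum realizer of `{x ↮ b}` whose `x`-cluster misses `o`, either `o ↔ b` or the support boundary of `C(o)` is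
empty — whence `Corner.realizers_stranded_eq`: the order-`m` realizers of `{o ↮ A} ∩ {u ↮ b}` do not depend on the
relay `u` (they are the configurations in which ONE cluster swallows all of `A` and avoids `o, b`), so the "stranded"
parts of `L_m({u ↮ b})` agree for all relays and the two-class analysis of layer 3 transfers from a maximal class to
the least reliable relay. [folklore] bookkeeping + the landed tripod exchange; nothing about the crux is asserted.
-/

noncomputable section

namespace Summit.CriticalPhenomena.PercolationContinuityZ3.Theorems

open MeasureTheory Filter Topology Finset
open Literature.Probability.LatticeModels Literature.Probability.Percolation

namespace Corner

open scoped Classical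

variable {V : Type*} [Fintype V] [DecidableEq V]

/-! ### The stranded-observer lemma -/

/-- **Stranded observer.** Let the closed set `E \ S` be exactly the boundary of `U = C(x)`, of size `m`, every
vertex set containing `x` but not `b` having at least `m` boundary pairs; if `o ∉ U` and `o ↮ b` in `↑S`, then
the support boundary of `C(o)` is empty. (Otherwise `U ∪ C(o)` would be an `x`–`b` cut with fewer than `m`
boundary pairs.) [folklore] -/
theorem card_bdry_clus_eq_zero_of_stranded {E S : Finset (Sym2 V)} {x o b : V} {m : ℕ}
    (hreal : E \ S = bdry E (clus (↑S : Set (Sym2 V)) x))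
    (hcard : (bdry E (clus (↑S : Set (Sym2 V)) x)).card = m)
    (hb : b ∉ clus (↑S : Set (Sym2 V)) x) (ho : o ∉ clus (↑S : Set (Sym2 V)) x)
    (hob : ¬ (openGraph (↑S : Set (Sym2 V))).Reachable o b)
    (hmin : ∀ W : Finset V, x ∈ W → b ∉ W → m ≤ (bdry E W).card) :
    (bdry E (clus (↑S : Set (Sym2 V)) o)).card = 0 := by
  set U := clus (↑S : Set (Sym2 V)) x with hU
  set K := clus (↑S : Set (Sym2 V)) o with hK
  have hKU : Disjoint K U := disjoint_clus_of_not_reachable fun h => ho (mem_clus.2 h.symm)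
  have hKsub : bdry E K ⊆ bdry E U := by rw [← hreal]; exact bdry_clus_subset_sdiff o
  -- the cut W = U ∪ K
  have hxW : x ∈ U ∪ K := Finset.mem_union_left _ (mem_clus.2 SimpleGraph.Reachable.rfl)
  have hbW : b ∉ U ∪ K := by
    rw [Finset.mem_union, not_or]; exact ⟨hb, fun h => hob (mem_clus.1 h)⟩
  -- bdry (U ∪ K) ⊆ bdry U \ bdry K
  have hWsub : bdry E (U ∪ K) ⊆ bdry E U \ bdry E K := by
    intro e he
    obtain ⟨heE, w, hw, z, hz, rfl⟩ := mem_bdry.1 he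
    rw [Finset.mem_union, not_or] at hz
    rw [Finset.mem_sdiff]
    rcases Finset.mem_union.1 hw with hwU | hwK
    · refine ⟨mem_bdry.2 ⟨heE, w, hwU, z, hz.1, rfl⟩, fun heK => ?_⟩
      rcases crosses_mk_iff.1 (mem_bdry.1 heK).2 with ⟨hwK, -⟩ | ⟨hzK, -⟩
      · exact Finset.disjoint_left.1 hKU hwK hwU
      · exact hz.2 hzK
    · -- w ∈ K, z ∉ K: the pair is closed (else z ∈ K), hence in bdry U, hence crosses U: impossible
      exfalso
      have heK : s(w, z) ∈ bdry E K := mem_bdry.2 ⟨heE, w, hwK, z, hz.2, rfl⟩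
      have heU := hKsub heK
      rcases crosses_mk_iff.1 (mem_bdry.1 heU).2 with ⟨hwU, -⟩ | ⟨hzU, -⟩
      · exact Finset.disjoint_left.1 hKU hwK hwU
      · exact hz.1 hzU
  have hcardW : (bdry E (U ∪ K)).card ≤ m - (bdry E K).card := by
    calc (bdry E (U ∪ K)).card ≤ (bdry E U \ bdry E K).card := Finset.card_le_card hWsub
      _ = (bdry E U).card - (bdry E K).card := Finset.card_sdiff_of_subset hKsub
      _ = m - (bdry E K).card := by rw [hcard]
  have hmW := hmin (U ∪ K) hxW hbW
  have hKle : (bdry E K).card ≤ m := by rw [← hcard]; exact Finset.card_le_card hKsub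
  omega

/-- In a configuration supported in `E`, a vertex whose cluster has empty support boundary is joined to every
vertex it is joined to in the full support. [folklore] -/
theorem reachable_of_card_bdry_clus_eq_zero {E S : Finset (Sym2 V)} {o a : V}
    (h0 : (bdry E (clus (↑S : Set (Sym2 V)) o)).card = 0)
    (ha : (openGraph (↑E : Set (Sym2 V))).Reachable o a) :
    (openGraph (↑S : Set (Sym2 V))).Reachable o a :=
  mem_clus.1 (reachable_mem_of_card_bdry_eq_zero (Finset.Subset.refl E) h0 ha
    (mem_clus.2 SimpleGraph.Reachable.rfl))

/-! ### The stranded realizers do not depend on the relay -/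

/-- **Stranded realizers.** If every relay's disconnection event has order `≥ m` and `o` is joined to some relay
in the support, then for any two relays `u, s` the order-`m` realizers of `{o ↮ A} ∩ {u ↮ b}` and of
`{o ↮ A} ∩ {s ↮ b}` coincide (in each, one cluster contains all of `A` and avoids `o, b`). [folklore] -/
theorem realizers_stranded_eq (E : Finset (Sym2 V)) (m : ℕ) (A : Finset V) (o b : V)
    (hm : ∀ a ∈ A, ∀ T ∈ E.powerset, (↑T : Set (Sym2 V)) ∈ (openConn a b)ᶜ → m ≤ (E \ T).card)
    (hsupp : ∃ a ∈ A, (openGraph (↑E : Set (Sym2 V))).Reachable o a)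
    {u s : V} (hu : u ∈ A) (hs : s ∈ A) :
    realizers E ((⋃ a ∈ A, openConn o a)ᶜ ∩ (openConn u b)ᶜ) m =
      realizers E ((⋃ a ∈ A, openConn o a)ᶜ ∩ (openConn s b)ᶜ) m := by
  -- key: in such a realizer for `u`, every relay lies in `C(u)`
  have key : ∀ {u : V}, u ∈ A → ∀ {S : Finset (Sym2 V)},
      S ∈ realizers E ((⋃ a ∈ A, openConn o a)ᶜ ∩ (openConn u b)ᶜ) m →
      ∀ a ∈ A, (openGraph (↑S : Set (Sym2 V))).Reachable u a := by
    intro u hu S hS a ha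
    obtain ⟨hSE, hD, hcard⟩ := mem_realizers.1 hS
    simp only [Set.mem_inter_iff, Set.mem_compl_iff, Set.mem_iUnion, openConn, Set.mem_setOf_eq,
      not_exists] at hD
    obtain ⟨hoA, hub⟩ := hD
    by_contra hua
    -- U = C(u) is a minimum realizer
    have hself : u ∈ clus (↑S : Set (Sym2 V)) u := mem_clus.2 SimpleGraph.Reachable.rfl
    have hbU : b ∉ clus (↑S : Set (Sym2 V)) u := fun h => hub (mem_clus.1 h)
    have hle : (E \ S).card ≤ (bdry E (clus (↑S : Set (Sym2 V)) u)).card := by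
      rw [hcard]; exact le_card_bdry_of_order (hm u hu) hself hbU
    have hreal := sdiff_eq_bdry_clus_of_card_le u hle
    have hc : (bdry E (clus (↑S : Set (Sym2 V)) u)).card = m := by rw [← hreal, hcard]
    have hoU : o ∉ clus (↑S : Set (Sym2 V)) u := fun h => hoA u hu (mem_clus.1 h).symm
    have haU : a ∉ clus (↑S : Set (Sym2 V)) u := fun h => hua (mem_clus.1 h)
    have hmin_u : ∀ W : Finset V, u ∈ W → b ∉ W → m ≤ (bdry E W).card :=
      fun W h h' => le_card_bdry_of_order (hm u hu) h h'
    have hmin_a : ∀ W : Finset V, a ∈ W → b ∉ W → m ≤ (bdry E W).card :=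
      fun W h h' => le_card_bdry_of_order (hm a ha) h h'
    rcases Nat.eq_zero_or_pos m with h0 | hpos
    · -- order 0: S = E, and o reaches some relay in the support
      subst h0
      have hSE' : S = E := Finset.Subset.antisymm hSE
        (Finset.sdiff_eq_empty_iff_subset.1 (Finset.card_eq_zero.1 hcard))
      obtain ⟨a', ha', hoa'⟩ := hsupp
      rw [← hSE'] at hoa'
      exact hoA a' ha' hoa'
    · -- m ≥ 1: the relay `a` outside `C(u)` is joined to `b`; if `o ↔ b` then `o ↔ a`, else `o` is stranded
      have hab : (openGraph (↑S : Set (Sym2 V))).Reachable a b :=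
        reachable_target_of_min_realizer hpos hreal hc hbU haU hmin_u hmin_a
      by_cases hob : (openGraph (↑S : Set (Sym2 V))).Reachable o b
      · exact hoA a ha (hob.trans hab.symm)
      · have h0 := card_bdry_clus_eq_zero_of_stranded hreal hc hbU hoU hob hmin_u
        obtain ⟨a', ha', hoa'⟩ := hsupp
        exact hoA a' ha' (reachable_of_card_bdry_clus_eq_zero h0 hoa')
  -- symmetric inclusion
  have incl : ∀ {u s : V}, u ∈ A → s ∈ A →
      realizers E ((⋃ a ∈ A, openConn o a)ᶜ ∩ (openConn u b)ᶜ) m ⊆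
        realizers E ((⋃ a ∈ A, openConn o a)ᶜ ∩ (openConn s b)ᶜ) m := by
    intro u s hu hs S hS
    have hall := key hu hS
    obtain ⟨hSE, hD, hcard⟩ := mem_realizers.1 hS
    refine mem_realizers.2 ⟨hSE, ?_, hcard⟩
    simp only [Set.mem_inter_iff, Set.mem_compl_iff, openConn, Set.mem_setOf_eq] at hD ⊢
    refine ⟨hD.1, fun hsb => hD.2 ((hall s hs).trans hsb)⟩
  exact Finset.Subset.antisymm (incl hu hs) (incl hs hu)

/-! ### Splitting `{x ↮ b}` by `o ↔ A` -/

omit [Fintype V] in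
/-- The realizers of `{x ↮ b}` split into those with `o ↔ A` and those with `o ↮ A`. [folklore] -/
theorem leading_split_oA (E : Finset (Sym2 V)) (lam : Sym2 V → ℝ) (m : ℕ) (A : Finset V) (o b x : V) :
    leading E lam (openConn x b)ᶜ m =
      leading E lam ((⋃ a ∈ A, openConn o a) ∩ (openConn x b)ᶜ) m +
        leading E lam ((⋃ a ∈ A, openConn o a)ᶜ ∩ (openConn x b)ᶜ) m := by
  rw [leading_eq_famWeight, leading_eq_famWeight, leading_eq_famWeight, famWeight, famWeight, famWeight,
    ← Finset.sum_union]
  · congr 1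
    ext S
    simp only [Finset.mem_union, mem_realizers, Set.mem_inter_iff, Set.mem_compl_iff]
    tauto
  · rw [Finset.disjoint_left]
    intro S h1 h2
    exact ((mem_realizers.1 h2).2.1).1 ((mem_realizers.1 h1).2.1).1

/-! ### Worst-relay gluing at the corner -/

/-- **Worst-relay gluing (KN Question 7) at the reliable corner, coefficient form, all `|A|`.** In the regime of
`leading_exit_le` (every relay's disconnection event has order `≥ m`, and the exit event has a realizer of order `m`),
for every relay `s` whose order-`m` disconnection coefficient is maximal ("least reliable at leading order"):
`L_m({o ↔ A} ∩ {o ↮ b}) ≤ L_m({o ↔ A} ∩ {s ↮ b})`. [folklore] (new here) -/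
theorem leading_exit_le_worstRelay (E : Finset (Sym2 V)) (lam : Sym2 V → ℝ) (hlam : ∀ e ∈ E, 0 ≤ lam e)
    (A : Finset V) (o b : V) (m : ℕ)
    (hm : ∀ a ∈ A, ∀ T ∈ E.powerset, (↑T : Set (Sym2 V)) ∈ (openConn a b)ᶜ → m ≤ (E \ T).card)
    (hX : (realizers E (exitEvent A o b) m).Nonempty)
    {s : V} (hs : s ∈ A) (hmax : ∀ a ∈ A, leading E lam (openConn a b)ᶜ m ≤ leading E lam (openConn s b)ᶜ m) :
    leading E lam (exitEvent A o b) m ≤ leading E lam ((⋃ a ∈ A, openConn o a) ∩ (openConn s b)ᶜ) m := by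
  have hA : A.Nonempty := by
    obtain ⟨S, hS⟩ := hX
    obtain ⟨a, ha, -⟩ := mem_realizers_exit_iff.1 hS
    exact ⟨a, ha⟩
  -- support connectivity of `o` to a relay
  have hsupp : ∃ a ∈ A, (openGraph (↑E : Set (Sym2 V))).Reachable o a := by
    obtain ⟨S, hS⟩ := hX
    obtain ⟨a, ha, hSa⟩ := mem_realizers_exit_iff.1 hS
    obtain ⟨hSE, -, -, hao⟩ := mem_upFam.1 hSa
    exact ⟨a, ha, (hao.mono (openGraph_mono (by exact_mod_cast hSE))).symm⟩
  -- Step 1: some maximal class u with L_m(X) ≤ L_m({o~A} ∩ D_u)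
  have step1 : ∃ u ∈ A, leading E lam (exitEvent A o b) m ≤
      leading E lam ((⋃ a ∈ A, openConn o a) ∩ (openConn u b)ᶜ) m := by
    obtain ⟨t₁, ht₁, t₂, ht₂, hcov⟩ := exists_two_cover A (upFam E m o b) hA
      (fun t₁ h₁ t₂ h₂ t₃ h₃ => upFam_no_three_antichain E m o b (hm t₁ h₁) (hm t₂ h₂) (hm t₃ h₃))
    have hXeq : realizers E (exitEvent A o b) m = upFam E m o b t₁ ∪ upFam E m o b t₂ := by
      ext S
      rw [mem_realizers_exit_iff, Finset.mem_union]
      constructor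
      · rintro ⟨a, ha, hS⟩
        rcases hcov a ha with h | h
        · exact Or.inl (h hS)
        · exact Or.inr (h hS)
      · rintro (h | h)
        · exact ⟨t₁, ht₁, h⟩
        · exact ⟨t₂, ht₂, h⟩
    -- the target family G_u ⊇ F_u
    have GsupF : ∀ u ∈ A, upFam E m o b u ⊆ realizers E ((⋃ a ∈ A, openConn o a) ∩ (openConn u b)ᶜ) m := by
      intro u huA S hS
      obtain ⟨hSE, hub, hcard, huo⟩ := mem_upFam.1 hS
      refine mem_realizers.2 ⟨hSE, ?_, hcard⟩
      simp only [Set.mem_inter_iff, Set.mem_compl_iff, Set.mem_iUnion, openConn, Set.mem_setOf_eq]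
      exact ⟨⟨u, huA, huo.symm⟩, hub⟩
    rw [leading_eq_famWeight, hXeq]
    by_cases h21 : upFam E m o b t₂ ⊆ upFam E m o b t₁
    · refine ⟨t₁, ht₁, ?_⟩
      rw [Finset.union_eq_left.2 h21, leading_eq_famWeight]
      exact famWeight_mono hlam (GsupF t₁ ht₁)
    by_cases h12 : upFam E m o b t₁ ⊆ upFam E m o b t₂
    · refine ⟨t₂, ht₂, ?_⟩
      rw [Finset.union_eq_right.2 h12, leading_eq_famWeight]
      exact famWeight_mono hlam (GsupF t₂ ht₂)
    -- incomparable: m ≥ 1 and the tripod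
    have hm1 : 1 ≤ m := by
      rcases Nat.eq_zero_or_pos m with h0 | hpos
      · exfalso
        subst h0
        obtain ⟨S, hS₁, hS₁'⟩ := Finset.not_subset.1 h12
        obtain ⟨S', hS₂, hS₂'⟩ := Finset.not_subset.1 h21
        rw [eq_of_mem_upFam_zero hS₁] at hS₁
        rw [eq_of_mem_upFam_zero hS₂] at hS₂'
        exact hS₂' hS₁
      · exact hpos
    set F₁ := upFam E m o b t₁ with hF₁
    set F₂ := upFam E m o b t₂ with hF₂
    set G₁ := realizers E ((⋃ a ∈ A, openConn o a) ∩ (openConn t₁ b)ᶜ) m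
    set G₂ := realizers E ((⋃ a ∈ A, openConn o a) ∩ (openConn t₂ b)ᶜ) m
    set p₁ := famWeight E lam (F₂ \ F₁)
    set p₂ := famWeight E lam (F₁ \ F₂)
    set g₁ := famWeight E lam (G₁ \ F₁)
    set g₂ := famWeight E lam (G₂ \ F₂)
    have hW₁ : famWeight E lam (F₁ ∪ F₂) = famWeight E lam F₁ + p₁ := famWeight_union_eq F₁ F₂
    have hW₂ : famWeight E lam (F₁ ∪ F₂) = famWeight E lam F₂ + p₂ := by
      rw [Finset.union_comm]; exact famWeight_union_eq F₂ F₁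
    have hG₁ : leading E lam ((⋃ a ∈ A, openConn o a) ∩ (openConn t₁ b)ᶜ) m = famWeight E lam F₁ + g₁ := by
      rw [leading_eq_famWeight]; exact famWeight_eq_add_sdiff (GsupF t₁ ht₁)
    have hG₂ : leading E lam ((⋃ a ∈ A, openConn o a) ∩ (openConn t₂ b)ᶜ) m = famWeight E lam F₂ + g₂ := by
      rw [leading_eq_famWeight]; exact famWeight_eq_add_sdiff (GsupF t₂ ht₂)
    -- tripod events
    set T₁ : Set (Set (Sym2 V)) := openConn o t₂ ∩ openConn t₁ b ∩ (openConn t₂ t₁)ᶜ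
    set T₂ : Set (Set (Sym2 V)) := openConn o t₁ ∩ openConn t₂ b ∩ (openConn t₂ t₁)ᶜ
    set T₃ : Set (Set (Sym2 V)) := openConn o t₂ ∩ openConn t₂ b ∩ (openConn t₂ t₁)ᶜ
    set T₄ : Set (Set (Sym2 V)) := openConn o t₁ ∩ openConn t₁ b ∩ (openConn t₂ t₁)ᶜ
    have hp₁ : p₁ ≤ leading E lam T₁ m := by
      rw [leading_eq_famWeight]
      exact famWeight_mono hlam fun S hS =>
        mem_realizers_tripod_of_mem_sdiff hm1 (hm t₁ ht₁) (hm t₂ ht₂) (Finset.mem_sdiff.1 hS).1 (Finset.mem_sdiff.1 hS).2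
    have hp₂ : p₂ ≤ leading E lam T₂ m := by
      rw [leading_eq_famWeight]
      refine famWeight_mono hlam fun S hS => ?_
      have h := mem_realizers_tripod_of_mem_sdiff hm1 (hm t₂ ht₂) (hm t₁ ht₁)
        (Finset.mem_sdiff.1 hS).1 (Finset.mem_sdiff.1 hS).2
      obtain ⟨hSE, hT, hcard⟩ := mem_realizers.1 h
      refine mem_realizers.2 ⟨hSE, ?_, hcard⟩
      simp only [Set.mem_inter_iff, Set.mem_compl_iff, openConn, Set.mem_setOf_eq] at hT ⊢
      exact ⟨hT.1, fun h' => hT.2 h'.symm⟩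
    -- realizers of T₃ lie in G₁ \ F₁ (o ↔ t₂ ∈ A gives o ↔ A), similarly T₄
    have hT3 : realizers E T₃ m ⊆ G₁ \ F₁ := by
      intro S hS
      have h := realizers_tripod_subset_sdiff E m o b t₁ t₂ hS
      obtain ⟨hSE, hT, hcard⟩ := mem_realizers.1 hS
      rw [Finset.mem_sdiff] at h ⊢
      refine ⟨mem_realizers.2 ⟨hSE, ?_, hcard⟩, h.2⟩
      simp only [Set.mem_inter_iff, Set.mem_compl_iff, Set.mem_iUnion, openConn, Set.mem_setOf_eq] at hT ⊢
      exact ⟨⟨t₂, ht₂, hT.1.1⟩, (mem_realizers.1 h.1).2.1⟩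
    have hT4 : realizers E T₄ m ⊆ G₂ \ F₂ := by
      intro S hS
      have hS' : S ∈ realizers E (openConn o t₁ ∩ openConn t₁ b ∩ (openConn t₁ t₂)ᶜ) m := by
        obtain ⟨hSE, hT, hcard⟩ := mem_realizers.1 hS
        refine mem_realizers.2 ⟨hSE, ?_, hcard⟩
        simp only [Set.mem_inter_iff, Set.mem_compl_iff, openConn, Set.mem_setOf_eq] at hT ⊢
        exact ⟨hT.1, fun h' => hT.2 h'.symm⟩
      have h := realizers_tripod_subset_sdiff E m o b t₂ t₁ hS'
      obtain ⟨hSE, hT, hcard⟩ := mem_realizers.1 hS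
      rw [Finset.mem_sdiff] at h ⊢
      refine ⟨mem_realizers.2 ⟨hSE, ?_, hcard⟩, h.2⟩
      simp only [Set.mem_inter_iff, Set.mem_compl_iff, Set.mem_iUnion, openConn, Set.mem_setOf_eq] at hT ⊢
      exact ⟨⟨t₁, ht₁, hT.1.1⟩, (mem_realizers.1 h.1).2.1⟩
    have hq₁ : leading E lam T₃ m ≤ g₁ := by rw [leading_eq_famWeight]; exact famWeight_mono hlam hT3
    have hq₂ : leading E lam T₄ m ≤ g₂ := by rw [leading_eq_famWeight]; exact famWeight_mono hlam hT4
    have hC : leading E lam T₁ m * leading E lam T₂ m ≤ leading E lam T₃ m * leading E lam T₄ m := by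
      refine leading_mul_le_of_real_mul_le E lam hlam T₁ T₂ T₃ T₄ m ?_ ?_ ?_ ?_
        (Filter.Eventually.of_forall fun ε => tripodExchange (cornerWeight E lam ε) o t₂ t₁ b)
      · intro S hS hD
        have h := order_tripod_left (o := o) (hm t₂ ht₂) S hS hD
        convert h using 2
        ext e; simp only [Finset.mem_sdiff]
      · intro S hS hD
        have hD' : (↑S : Set (Sym2 V)) ∈ openConn o t₁ ∩ openConn t₂ b ∩ (openConn t₁ t₂)ᶜ := by
          simp only [Set.mem_inter_iff, Set.mem_compl_iff, openConn, Set.mem_setOf_eq] at hD ⊢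
          exact ⟨hD.1, fun h' => hD.2 h'.symm⟩
        have h := order_tripod_left (o := o) (hm t₁ ht₁) S hS hD'
        convert h using 2
        ext e; simp only [Finset.mem_sdiff]
      · intro S hS hD
        have h := order_tripod_right (o := o) (hm t₁ ht₁) S hS hD
        convert h using 2
        ext e; simp only [Finset.mem_sdiff]
      · intro S hS hD
        have hD' : (↑S : Set (Sym2 V)) ∈ openConn o t₁ ∩ openConn t₁ b ∩ (openConn t₁ t₂)ᶜ := by
          simp only [Set.mem_inter_iff, Set.mem_compl_iff, openConn, Set.mem_setOf_eq] at hD ⊢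
          exact ⟨hD.1, fun h' => hD.2 h'.symm⟩
        have h := order_tripod_right (o := o) (hm t₂ ht₂) S hS hD'
        convert h using 2
        ext e; simp only [Finset.mem_sdiff]
    have hg₁ : 0 ≤ g₁ := famWeight_nonneg hlam _
    have hg₂ : 0 ≤ g₂ := famWeight_nonneg hlam _
    have hL₁ : 0 ≤ leading E lam T₁ m := leading_nonneg E lam hlam T₁ m
    have hL₄ : 0 ≤ leading E lam T₄ m := leading_nonneg E lam hlam T₄ m
    have hp₂nn : 0 ≤ p₂ := famWeight_nonneg hlam _
    rcases le_or_gt p₁ g₁ with hle₁ | hlt₁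
    · refine ⟨t₁, ht₁, ?_⟩
      rw [hG₁, hW₁]; linarith
    rcases le_or_gt p₂ g₂ with hle₂ | hlt₂
    · refine ⟨t₂, ht₂, ?_⟩
      rw [hG₂, hW₂]; linarith
    exfalso
    have h1 : p₁ * p₂ ≤ leading E lam T₁ m * leading E lam T₂ m := mul_le_mul hp₁ hp₂ hp₂nn hL₁
    have h2 : leading E lam T₃ m * leading E lam T₄ m ≤ g₁ * g₂ := mul_le_mul hq₁ hq₂ hL₄ hg₁
    have h3 : g₁ * g₂ < p₁ * p₂ := mul_lt_mul'' hlt₁ hlt₂ hg₁ hg₂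
    linarith
  -- Step 2: transfer from u to the least reliable relay s through the relay-independent stranded part
  obtain ⟨u, hu, hle⟩ := step1
  have hsplit_u := leading_split_oA E lam m A o b u
  have hsplit_s := leading_split_oA E lam m A o b s
  have hstr : leading E lam ((⋃ a ∈ A, openConn o a)ᶜ ∩ (openConn u b)ᶜ) m =
      leading E lam ((⋃ a ∈ A, openConn o a)ᶜ ∩ (openConn s b)ᶜ) m := by
    rw [leading_eq_famWeight, leading_eq_famWeight, realizers_stranded_eq E m A o b hm hsupp hu hs]
  have hNs := hmax u hu
  linarith

end Corner

end Summit.CriticalPhenomena.PercolationContinuityZ3.Theorems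

end
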